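import Summits.Ventures.HodgeRepro2.T5SU11SphericalDeriv

/-!
# The radial differential equation of the spherical functions of `SU(1,1)`:
`u'' + 2 coth 2t · u' = λ(λ − 2) u` for `u(t) = φ_λ(a_t)`

With `B = cosh 2t − sinh 2t cos φ`, `u(t) = sph λ (a_t) = (2π)⁻¹ ∫_{-π}^{π} B^{-λ/2} dφ` and the
derivative integrals of `T5SU11SphericalDeriv` (`u' = (2π)⁻¹ ∫ F'`, `u'' = (2π)⁻¹ ∫ F''` with
`F' = B_t μ B^{μ-1}`, `F'' = B_tt μ B^{μ-1} + (B_t μ)(B_t (μ-1) B^{μ-2})`, `μ = -λ/2`), the pointwise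
identity
`sinh 2t · F'' + 2 cosh 2t · F' − λ(λ−2) sinh 2t · B^{μ} = -4μ · ∂_φ [sin φ · B^{μ-1}]`
(`ode_pointwise`: a polynomial identity modulo `cosh² − sinh² = 1`, `sin² + cos² = 1`, after writing
`B^{μ} = B^{μ-2} B²`, `B^{μ-1} = B^{μ-2} B`; the `φ`-derivative is `hasDerivAt_sin_mul_laplace_rpow`,
`∂_φ B = sinh 2t sin φ`) integrates to zero over `[-π, π]` (`integral_deriv_sin_mul_laplace_rpow`, the
boundary term `sin φ · B^{μ-1}` vanishing at `±π`). Hence **the radial ODE in the form valid for every `t`**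
`sinh 2t · u''(t) + 2 cosh 2t · u'(t) = λ(λ − 2) sinh 2t · u(t)` (`sph_hyp_ode`), packaged as
**`∃ u' u'', (∀ t, HasDerivAt u (u' t) t) ∧ (∀ t, HasDerivAt u' (u'' t) t) ∧ ∀ t, sinh 2t · u'' t + 2 cosh 2t · u' t
= λ(λ−2) sinh 2t · u t`** (`exists_hasDerivAt_sph_hyp_ode`), and in the classical form
**`u'' + 2 coth 2t · u' = λ(λ − 2) u` for `t ≠ 0`** with `u' = deriv u`, `u'' = deriv (deriv u)`
(`deriv_deriv_sph_hyp`, `sph_hyp_ode_div`): `φ_λ` is an eigenfunction of the radial part of the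
Laplacian of the explicit model with eigenvalue `λ(λ − 2ρ)`, `2ρ = 2`. Nothing is claimed about (N).

Blind lane: Mathlib + the HodgeRepro2 prefix only; no sorry; axioms ⊆ {propext, Classical.choice,
Quot.sound}.
-/

namespace Summit.Ventures.HodgeRepro2.T5SU11SphericalODE

open MeasureTheory Metric Set Filter Topology Complex intervalIntegral
open T5SU11Unimodular T5SU11Fibration T5SU11Cartan T5SU11OneParameter T5SU11CartanProjection
  T5HaarCircle T5BergmanCoefficient T5SU11SphericalFunction T5SU11SphericalTwo
  T5SU11SphericalSymmetry T5SU11SphericalBounds T5SU11SphericalContinuous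
  T5SU11SphericalAsymptotic T5SU11SphericalLp T5SU11SphericalCfun T5SU11SphericalLpSharp
  T5SU11SphericalXiLog T5SU11SphericalCfunLimit T5SU11SphericalStrict T5SU11SphericalDeriv
open scoped Real

/-! ### The `φ`-derivative of `sin φ · B^{μ-1}` and the boundary identity -/

/-- `∂_φ (cosh 2t − sinh 2t cos φ) = sinh 2t sin φ`. -/
lemma hasDerivAt_laplace_base_phi (t φ : ℝ) :
    HasDerivAt (fun φ => Real.cosh (2 * t) - Real.sinh (2 * t) * Real.cos φ)
      (Real.sinh (2 * t) * Real.sin φ) φ :=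
  (((Real.hasDerivAt_cos φ).const_mul (Real.sinh (2 * t))).const_sub (Real.cosh (2 * t))).congr_deriv
    (by ring)

/-- `∂_φ [sin φ · B^{μ-1}] = cos φ · B^{μ-1} + sin φ · (sinh 2t sin φ · (μ-1) · B^{μ-2})`. -/
lemma hasDerivAt_sin_mul_laplace_rpow (μ t φ : ℝ) :
    HasDerivAt (fun φ => Real.sin φ * (Real.cosh (2 * t) - Real.sinh (2 * t) * Real.cos φ) ^ (μ - 1))
      (Real.cos φ * (Real.cosh (2 * t) - Real.sinh (2 * t) * Real.cos φ) ^ (μ - 1) +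
        Real.sin φ * (Real.sinh (2 * t) * Real.sin φ * (μ - 1) *
          (Real.cosh (2 * t) - Real.sinh (2 * t) * Real.cos φ) ^ (μ - 1 - 1))) φ :=
  (Real.hasDerivAt_sin φ).mul
    ((hasDerivAt_laplace_base_phi t φ).rpow_const (Or.inl (laplace_base_pos t φ).ne'))

/-- `φ ↦ B(t, φ)` is continuous. -/
lemma continuous_laplace_base_phi (t : ℝ) :
    Continuous fun φ => Real.cosh (2 * t) - Real.sinh (2 * t) * Real.cos φ := by
  fun_prop

/-- `φ ↦ B(t, φ)^μ` is continuous. -/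
lemma continuous_laplace_rpow_phi (μ t : ℝ) :
    Continuous fun φ => (Real.cosh (2 * t) - Real.sinh (2 * t) * Real.cos φ) ^ μ :=
  (continuous_laplace_base_phi t).rpow_const fun φ => Or.inl (laplace_base_pos t φ).ne'

/-- `φ ↦ B_t(t, φ)` is continuous. -/
lemma continuous_laplace_base_deriv_phi (t : ℝ) :
    Continuous fun φ => 2 * Real.sinh (2 * t) - 2 * Real.cosh (2 * t) * Real.cos φ := by
  fun_prop

/-- `φ ↦ B_tt(t, φ)` is continuous. -/
lemma continuous_laplace_base_deriv2_phi (t : ℝ) :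
    Continuous fun φ => 4 * Real.cosh (2 * t) - 4 * Real.sinh (2 * t) * Real.cos φ := by
  fun_prop

/-- **The boundary identity**: `∫_{-π}^{π} ∂_φ [sin φ · B^{μ-1}] dφ = 0`. -/
lemma integral_deriv_sin_mul_laplace_rpow (μ t : ℝ) :
    ∫ φ in (-π)..π, (Real.cos φ * (Real.cosh (2 * t) - Real.sinh (2 * t) * Real.cos φ) ^ (μ - 1) +
      Real.sin φ * (Real.sinh (2 * t) * Real.sin φ * (μ - 1) *
        (Real.cosh (2 * t) - Real.sinh (2 * t) * Real.cos φ) ^ (μ - 1 - 1))) = 0 := by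
  rw [integral_eq_sub_of_hasDerivAt (fun φ _ => hasDerivAt_sin_mul_laplace_rpow μ t φ) ?_]
  · simp only [Real.sin_pi, Real.sin_neg, neg_zero, zero_mul, sub_zero]
  · refine Continuous.intervalIntegrable ?_ _ _
    exact (Real.continuous_cos.mul (continuous_laplace_rpow_phi (μ - 1) t)).add
      (Real.continuous_sin.mul (((continuous_const.mul Real.continuous_sin).mul continuous_const).mul
        (continuous_laplace_rpow_phi (μ - 1 - 1) t)))

/-! ### The pointwise identity -/

/-- **The pointwise identity behind the radial ODE**: with `μ = -λ/2`,
`sinh 2t · F'' + 2 cosh 2t · F' − λ(λ−2) sinh 2t · B^μ = -4μ · ∂_φ [sin φ · B^{μ-1}]`. -/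
lemma ode_pointwise (lam t φ : ℝ) :
    Real.sinh (2 * t) *
        ((4 * Real.cosh (2 * t) - 4 * Real.sinh (2 * t) * Real.cos φ) * (-lam / 2) *
            (Real.cosh (2 * t) - Real.sinh (2 * t) * Real.cos φ) ^ (-lam / 2 - 1) +
          (2 * Real.sinh (2 * t) - 2 * Real.cosh (2 * t) * Real.cos φ) * (-lam / 2) *
            ((2 * Real.sinh (2 * t) - 2 * Real.cosh (2 * t) * Real.cos φ) * (-lam / 2 - 1) *
              (Real.cosh (2 * t) - Real.sinh (2 * t) * Real.cos φ) ^ (-lam / 2 - 1 - 1))) +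
      2 * Real.cosh (2 * t) *
        ((2 * Real.sinh (2 * t) - 2 * Real.cosh (2 * t) * Real.cos φ) * (-lam / 2) *
          (Real.cosh (2 * t) - Real.sinh (2 * t) * Real.cos φ) ^ (-lam / 2 - 1)) -
      lam * (lam - 2) * Real.sinh (2 * t) *
        (Real.cosh (2 * t) - Real.sinh (2 * t) * Real.cos φ) ^ (-lam / 2) =
    -4 * (-lam / 2) *
      (Real.cos φ * (Real.cosh (2 * t) - Real.sinh (2 * t) * Real.cos φ) ^ (-lam / 2 - 1) +
        Real.sin φ * (Real.sinh (2 * t) * Real.sin φ * (-lam / 2 - 1) *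
          (Real.cosh (2 * t) - Real.sinh (2 * t) * Real.cos φ) ^ (-lam / 2 - 1 - 1))) := by
  have hB : 0 < Real.cosh (2 * t) - Real.sinh (2 * t) * Real.cos φ := laplace_base_pos t φ
  have hR1 : Real.cosh (2 * t) ^ 2 - Real.sinh (2 * t) ^ 2 = 1 := Real.cosh_sq_sub_sinh_sq (2 * t)
  have hR2 : Real.sin φ ^ 2 + Real.cos φ ^ 2 = 1 := Real.sin_sq_add_cos_sq φ
  have h1 : (Real.cosh (2 * t) - Real.sinh (2 * t) * Real.cos φ) ^ (-lam / 2 - 1) =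
      (Real.cosh (2 * t) - Real.sinh (2 * t) * Real.cos φ) ^ (-lam / 2 - 1 - 1) *
        (Real.cosh (2 * t) - Real.sinh (2 * t) * Real.cos φ) := by
    rw [← Real.rpow_add_one hB.ne']
    congr 1
    ring
  have h0 : (Real.cosh (2 * t) - Real.sinh (2 * t) * Real.cos φ) ^ (-lam / 2) =
      (Real.cosh (2 * t) - Real.sinh (2 * t) * Real.cos φ) ^ (-lam / 2 - 1 - 1) *
        (Real.cosh (2 * t) - Real.sinh (2 * t) * Real.cos φ) ^ 2 := by
    rw [← Real.rpow_natCast, ← Real.rpow_add hB]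
    congr 1
    push_cast
    ring
  rw [h1, h0]
  linear_combination
    ((-lam / 2) * (Real.cosh (2 * t) - Real.sinh (2 * t) * Real.cos φ) ^ (-lam / 2 - 1 - 1) *
      (4 * Real.sinh (2 * t) * (-lam / 2 - 1) * (Real.cos φ ^ 2 - 1) -
        4 * Real.cos φ * (Real.cosh (2 * t) - Real.sinh (2 * t) * Real.cos φ))) * hR1 +
    (4 * (-lam / 2) * (Real.cosh (2 * t) - Real.sinh (2 * t) * Real.cos φ) ^ (-lam / 2 - 1 - 1) *
      Real.sinh (2 * t) * (-lam / 2 - 1)) * hR2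

/-! ### The radial ODE -/

/-- `φ ↦ F'(t, φ)` is continuous. -/
lemma continuous_laplace_rpow_deriv_phi (μ t : ℝ) :
    Continuous fun φ => (2 * Real.sinh (2 * t) - 2 * Real.cosh (2 * t) * Real.cos φ) * μ *
      (Real.cosh (2 * t) - Real.sinh (2 * t) * Real.cos φ) ^ (μ - 1) :=
  ((continuous_laplace_base_deriv_phi t).mul continuous_const).mul
    (continuous_laplace_rpow_phi (μ - 1) t)

/-- `φ ↦ F''(t, φ)` is continuous. -/
lemma continuous_laplace_rpow_deriv2_phi (μ t : ℝ) :
    Continuous fun φ => (4 * Real.cosh (2 * t) - 4 * Real.sinh (2 * t) * Real.cos φ) * μ *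
        (Real.cosh (2 * t) - Real.sinh (2 * t) * Real.cos φ) ^ (μ - 1) +
      (2 * Real.sinh (2 * t) - 2 * Real.cosh (2 * t) * Real.cos φ) * μ *
        ((2 * Real.sinh (2 * t) - 2 * Real.cosh (2 * t) * Real.cos φ) * (μ - 1) *
          (Real.cosh (2 * t) - Real.sinh (2 * t) * Real.cos φ) ^ (μ - 1 - 1)) :=
  (((continuous_laplace_base_deriv2_phi t).mul continuous_const).mul
      (continuous_laplace_rpow_phi (μ - 1) t)).add
    (((continuous_laplace_base_deriv_phi t).mul continuous_const).mul
      (((continuous_laplace_base_deriv_phi t).mul continuous_const).mul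
        (continuous_laplace_rpow_phi (μ - 1 - 1) t)))

/-- **The integrated identity**: with `μ = -λ/2`,
`sinh 2t · ∫ F'' + 2 cosh 2t · ∫ F' − λ(λ−2) sinh 2t · ∫ B^μ = 0`. -/
theorem integral_ode_combination (lam t : ℝ) :
    Real.sinh (2 * t) * (∫ φ in (-π)..π,
        (4 * Real.cosh (2 * t) - 4 * Real.sinh (2 * t) * Real.cos φ) * (-lam / 2) *
            (Real.cosh (2 * t) - Real.sinh (2 * t) * Real.cos φ) ^ (-lam / 2 - 1) +
          (2 * Real.sinh (2 * t) - 2 * Real.cosh (2 * t) * Real.cos φ) * (-lam / 2) *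
            ((2 * Real.sinh (2 * t) - 2 * Real.cosh (2 * t) * Real.cos φ) * (-lam / 2 - 1) *
              (Real.cosh (2 * t) - Real.sinh (2 * t) * Real.cos φ) ^ (-lam / 2 - 1 - 1))) +
      2 * Real.cosh (2 * t) * (∫ φ in (-π)..π,
        (2 * Real.sinh (2 * t) - 2 * Real.cosh (2 * t) * Real.cos φ) * (-lam / 2) *
          (Real.cosh (2 * t) - Real.sinh (2 * t) * Real.cos φ) ^ (-lam / 2 - 1)) -
      lam * (lam - 2) * Real.sinh (2 * t) * (∫ φ in (-π)..π,
        (Real.cosh (2 * t) - Real.sinh (2 * t) * Real.cos φ) ^ (-lam / 2)) = 0 := by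
  have hI0 := (continuous_laplace_rpow_phi (-lam / 2) t).intervalIntegrable (μ := volume) (-π) π
  have hI1 := (continuous_laplace_rpow_deriv_phi (-lam / 2) t).intervalIntegrable (μ := volume)
    (-π) π
  have hI2 := (continuous_laplace_rpow_deriv2_phi (-lam / 2) t).intervalIntegrable (μ := volume)
    (-π) π
  have e := intervalIntegral.integral_congr (a := -π) (b := π) (μ := volume)
    fun φ _ => ode_pointwise lam t φ
  rw [intervalIntegral.integral_const_mul, integral_deriv_sin_mul_laplace_rpow, mul_zero,
    integral_sub (hI2.const_mul _ |>.add (hI1.const_mul _)) (hI0.const_mul _),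
    integral_add (hI2.const_mul _) (hI1.const_mul _), intervalIntegral.integral_const_mul,
    intervalIntegral.integral_const_mul, intervalIntegral.integral_const_mul] at e
  exact e

section measure

variable [MeasurableSpace Circle] [BorelSpace Circle]

/-- **The radial ODE for `u(t) = sph λ (a_t)`, valid for every `t`**:
`sinh 2t · u''(t) + 2 cosh 2t · u'(t) = λ(λ − 2) sinh 2t · u(t)`, with `u'`, `u''` the derivative integrals
of `T5SU11SphericalDeriv`. -/
theorem sph_hyp_ode (lam t : ℝ) :
    Real.sinh (2 * t) * ((2 * π)⁻¹ * ∫ φ in (-π)..π,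
        (4 * Real.cosh (2 * t) - 4 * Real.sinh (2 * t) * Real.cos φ) * (-lam / 2) *
            (Real.cosh (2 * t) - Real.sinh (2 * t) * Real.cos φ) ^ (-lam / 2 - 1) +
          (2 * Real.sinh (2 * t) - 2 * Real.cosh (2 * t) * Real.cos φ) * (-lam / 2) *
            ((2 * Real.sinh (2 * t) - 2 * Real.cosh (2 * t) * Real.cos φ) * (-lam / 2 - 1) *
              (Real.cosh (2 * t) - Real.sinh (2 * t) * Real.cos φ) ^ (-lam / 2 - 1 - 1))) +
      2 * Real.cosh (2 * t) * ((2 * π)⁻¹ * ∫ φ in (-π)..π,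
        (2 * Real.sinh (2 * t) - 2 * Real.cosh (2 * t) * Real.cos φ) * (-lam / 2) *
          (Real.cosh (2 * t) - Real.sinh (2 * t) * Real.cos φ) ^ (-lam / 2 - 1)) =
      lam * (lam - 2) * Real.sinh (2 * t) * sph lam (hyp t) := by
  rw [sph_hyp_eq_laplace]
  linear_combination (2 * π)⁻¹ * integral_ode_combination lam t

/-- **The radial ODE, packaged**: `u(t) = sph λ (a_t)` has derivatives `u'`, `u''` (as iterated
`HasDerivAt`) with `sinh 2t · u'' + 2 cosh 2t · u' = λ(λ − 2) sinh 2t · u`. -/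
theorem exists_hasDerivAt_sph_hyp_ode (lam : ℝ) :
    ∃ u' u'' : ℝ → ℝ, (∀ t, HasDerivAt (fun t => sph lam (hyp t)) (u' t) t) ∧
      (∀ t, HasDerivAt u' (u'' t) t) ∧
      ∀ t, Real.sinh (2 * t) * u'' t + 2 * Real.cosh (2 * t) * u' t =
        lam * (lam - 2) * Real.sinh (2 * t) * sph lam (hyp t) :=
  ⟨fun t => (2 * π)⁻¹ * ∫ φ in (-π)..π,
      (2 * Real.sinh (2 * t) - 2 * Real.cosh (2 * t) * Real.cos φ) * (-lam / 2) *
        (Real.cosh (2 * t) - Real.sinh (2 * t) * Real.cos φ) ^ (-lam / 2 - 1),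
    fun t => (2 * π)⁻¹ * ∫ φ in (-π)..π,
      (4 * Real.cosh (2 * t) - 4 * Real.sinh (2 * t) * Real.cos φ) * (-lam / 2) *
          (Real.cosh (2 * t) - Real.sinh (2 * t) * Real.cos φ) ^ (-lam / 2 - 1) +
        (2 * Real.sinh (2 * t) - 2 * Real.cosh (2 * t) * Real.cos φ) * (-lam / 2) *
          ((2 * Real.sinh (2 * t) - 2 * Real.cosh (2 * t) * Real.cos φ) * (-lam / 2 - 1) *
            (Real.cosh (2 * t) - Real.sinh (2 * t) * Real.cos φ) ^ (-lam / 2 - 1 - 1)),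
    fun t => hasDerivAt_sph_hyp lam t,
    fun t => (hasDerivAt_integral_laplace_deriv (-lam / 2) t).const_mul _,
    fun t => sph_hyp_ode lam t⟩

/-- **The second derivative of `t ↦ sph λ (a_t)` in closed form.** -/
theorem deriv_deriv_sph_hyp (lam t : ℝ) :
    deriv (deriv fun t => sph lam (hyp t)) t = (2 * π)⁻¹ * ∫ φ in (-π)..π,
      (4 * Real.cosh (2 * t) - 4 * Real.sinh (2 * t) * Real.cos φ) * (-lam / 2) *
          (Real.cosh (2 * t) - Real.sinh (2 * t) * Real.cos φ) ^ (-lam / 2 - 1) +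
        (2 * Real.sinh (2 * t) - 2 * Real.cosh (2 * t) * Real.cos φ) * (-lam / 2) *
          ((2 * Real.sinh (2 * t) - 2 * Real.cosh (2 * t) * Real.cos φ) * (-lam / 2 - 1) *
            (Real.cosh (2 * t) - Real.sinh (2 * t) * Real.cos φ) ^ (-lam / 2 - 1 - 1)) := by
  have e : deriv (fun t => sph lam (hyp t)) = fun t => (2 * π)⁻¹ * ∫ φ in (-π)..π,
      (2 * Real.sinh (2 * t) - 2 * Real.cosh (2 * t) * Real.cos φ) * (-lam / 2) *
        (Real.cosh (2 * t) - Real.sinh (2 * t) * Real.cos φ) ^ (-lam / 2 - 1) :=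
    funext (deriv_sph_hyp lam)
  rw [e]
  exact ((hasDerivAt_integral_laplace_deriv (-lam / 2) t).const_mul _).deriv

/-- **The radial ODE in the classical form**, `t ≠ 0`: for `u(t) = sph λ (a_t)`,
`u''(t) + 2 coth 2t · u'(t) = λ(λ − 2) u(t)`. -/
theorem sph_hyp_ode_div {lam t : ℝ} (ht : t ≠ 0) :
    deriv (deriv fun t => sph lam (hyp t)) t +
        2 * (Real.cosh (2 * t) / Real.sinh (2 * t)) * deriv (fun t => sph lam (hyp t)) t =
      lam * (lam - 2) * sph lam (hyp t) := by
  have hS : Real.sinh (2 * t) ≠ 0 := by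
    rw [Ne, Real.sinh_eq_zero]
    intro h
    exact ht (by linarith)
  have h := sph_hyp_ode lam t
  rw [deriv_deriv_sph_hyp, deriv_sph_hyp]
  set U2 := (2 * π)⁻¹ * ∫ φ in (-π)..π,
      (4 * Real.cosh (2 * t) - 4 * Real.sinh (2 * t) * Real.cos φ) * (-lam / 2) *
          (Real.cosh (2 * t) - Real.sinh (2 * t) * Real.cos φ) ^ (-lam / 2 - 1) +
        (2 * Real.sinh (2 * t) - 2 * Real.cosh (2 * t) * Real.cos φ) * (-lam / 2) *
          ((2 * Real.sinh (2 * t) - 2 * Real.cosh (2 * t) * Real.cos φ) * (-lam / 2 - 1) *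
            (Real.cosh (2 * t) - Real.sinh (2 * t) * Real.cos φ) ^ (-lam / 2 - 1 - 1)) with hU2
  set U1 := (2 * π)⁻¹ * ∫ φ in (-π)..π,
      (2 * Real.sinh (2 * t) - 2 * Real.cosh (2 * t) * Real.cos φ) * (-lam / 2) *
        (Real.cosh (2 * t) - Real.sinh (2 * t) * Real.cos φ) ^ (-lam / 2 - 1) with hU1
  have e : 1 / Real.sinh (2 * t) * (Real.sinh (2 * t) * U2 + 2 * Real.cosh (2 * t) * U1) =
      U2 + 2 * (Real.cosh (2 * t) / Real.sinh (2 * t)) * U1 := by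
    rw [mul_add, ← mul_assoc, one_div_mul_cancel hS, one_mul]
    ring
  rw [← e, h, show 1 / Real.sinh (2 * t) * (lam * (lam - 2) * Real.sinh (2 * t) * sph lam (hyp t)) =
    lam * (lam - 2) * sph lam (hyp t) * (1 / Real.sinh (2 * t) * Real.sinh (2 * t)) by ring,
    one_div_mul_cancel hS, mul_one]

end measure

end Summit.Ventures.HodgeRepro2.T5SU11SphericalODE
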